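import Summits.KontsevichZagierPeriods.Zeta5Search.Barrier.ConeGammaCuspPeriodWeights

/-!
# ζ(5) search — BARRIER: THE LOCAL CRITERION — the type of a pattern function is the sign pattern of its wall defects

HONEST FRAMING (cell `pub-zeta5`): systematic search; no irrationality claim unless kernel-certified. MODEL objects
under Brown–Zudilin's (28)+(30) accounting ([BZ22] = arXiv:2210.03391; (28) observed, not proved); nothing here is a
statement about `ζ(5)`, any `γ` of record, the cone's supremum (C2 OPEN) or the type of any pattern function at a named
direction (DATA of the cell); S-E stays CONJECTURED; records in print UNMOVED. Prover P2 g31, item «ONE SET FUNCTION»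
(INBOX 2026-08-27), file (6): PURE finite combinatorics (no saving function) + its reading on the period.

For a set function `f` on the subsets of a finset `M` the LOCAL DEFECT behind `S ⊆ M` at `k ≠ l ∈ M ∖ S` is
`m(S;k,l) = f(S∪{k}) + f(S∪{l}) − f(S) − f(S∪{k,l})` — by P2 g30 (6) / file (4) the KINK of the vote / of `σ` across
the coincidence wall `r_k = r_l` behind the prefix `S`. The classical local criterion (the lattice inequality from
adjacent-transposition inequalities; marginals decrease along chains):
* **`marginal_le_of_local_nonneg`** — all local defects `≥ 0` ⇒ `f(D∪{k}) − f(D) ≤ f(C∪{k}) − f(C)` for `C ⊆ D ⊆ M`,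
  `k ∈ M ∖ D` (diminishing returns);
* **`submodular_of_local_nonneg`** — all local defects `≥ 0` ⇒ `f(A ∪ B) + f(A ∩ B) ≤ f(A) + f(B)` for all
  `A, B ⊆ M`; `local_nonneg_of_submodular` (converse); **`supermodular_of_local_nonpos`**, `local_nonpos_of_supermodular`;
  **`modular_of_local_zero`**: THE TYPE OF A JUNCTION / OF THE PERIOD IS THE SIGN PATTERN OF ITS WALL DEFECTS (over all
  prefixes) — the desk's sampled local test (P2 g30 (C1), this seat's (L3)) tests exactly the hypothesis of the type
  theorems;
* on the period (with file (4)'s pooling identity): **`period_submodular_of_junction_local_nonneg`** — if at every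
  junction every local defect behind every prefix is `≥ 0`, the period pattern function `F` is submodular on all subsets
  of the 28 forms (so files (2)–(3) apply); `period_supermodular_of_junction_local_nonpos`; whence
  **`cuspSlope_eq_zero_of_junction_local_nonneg_of_isLocalMax`** (P2 g23's hypotheses verbatim: only convex kinks at
  every junction ⇒ a local maximiser of the MODEL `γ` is cusp-free) and
  `cuspSlope_nonpos_of_junction_local_nonpos_of_hull_certificate` (only concave kinks ⇒ the hull certificate applies).
NOT here: the sign of any defect at a named direction (DATA: both signs occur at all four); `γ`, C2, S-E, `ζ(5)`.
-/

noncomputable section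

open Set MeasureTheory Finset
open scoped Topology

namespace Summit.KontsevichZagierPeriods.Zeta5Search.Barrier.ConeGamma

/-! ### Diminishing marginals from non-negative local defects -/

/-- **DIMINISHING RETURNS FROM NON-NEGATIVE LOCAL DEFECTS.** If every local defect of `f` inside `M` is `≥ 0`
(`f(S∪{k,l}) + f(S) ≤ f(S∪{k}) + f(S∪{l})` for `S ⊆ M`, `k ≠ l ∈ M ∖ S`), then for `C ⊆ D ⊆ M` and `k ∈ M ∖ D`:
`f(D∪{k}) − f(D) ≤ f(C∪{k}) − f(C)`. (Induction on `#(D ∖ C)`: peel one element of `D ∖ C` with the local inequality.) -/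
theorem marginal_le_of_local_nonneg {M : Finset (Fin 28)} {f : Finset (Fin 28) → ℝ}
    (hloc : ∀ S, S ⊆ M → ∀ k ∈ M, ∀ l ∈ M, k ∉ S → l ∉ S → k ≠ l →
      f (insert k (insert l S)) + f S ≤ f (insert k S) + f (insert l S))
    {C D : Finset (Fin 28)} (hCD : C ⊆ D) (hD : D ⊆ M) {k : Fin 28} (hk : k ∈ M) (hkD : k ∉ D) :
    f (insert k D) - f D ≤ f (insert k C) - f C := by
  classical
  suffices h : ∀ n : ℕ, ∀ D : Finset (Fin 28), C ⊆ D → D ⊆ M → (D \ C).card = n → k ∉ D →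
      f (insert k D) - f D ≤ f (insert k C) - f C from h _ D hCD hD rfl hkD
  intro n
  induction n with
  | zero =>
    intro D hCD hD hcard _
    have hDC : D = C := Finset.Subset.antisymm
      (fun x hx => by
        by_contra hxC
        have : x ∈ D \ C := Finset.mem_sdiff.mpr ⟨hx, hxC⟩
        rw [Finset.card_eq_zero.mp hcard] at this
        exact absurd this (Finset.notMem_empty _)) hCD
    rw [hDC]
  | succ n ih =>
    intro D hCD hD hcard hkD
    obtain ⟨l, hl⟩ : (D \ C).Nonempty := Finset.card_pos.mp (by omega)
    obtain ⟨hlD, hlC⟩ := Finset.mem_sdiff.mp hl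
    have hkl : k ≠ l := fun h => hkD (h ▸ hlD)
    -- peel `l`: `D = insert l D'`
    have hCD' : C ⊆ D.erase l := fun x hx => Finset.mem_erase.mpr ⟨fun h => hlC (h ▸ hx), hCD hx⟩
    have hD'M : D.erase l ⊆ M := (Finset.erase_subset _ _).trans hD
    have hcard' : (D.erase l \ C).card = n := by
      rw [Finset.erase_sdiff_comm, Finset.card_erase_of_mem hl, hcard]; rfl
    have hkD' : k ∉ D.erase l := fun h => hkD (Finset.mem_of_mem_erase h)
    have hIH := ih (D.erase l) hCD' hD'M hcard' hkD'
    have hL := hloc (D.erase l) hD'M k hk l (hD hlD) hkD' (Finset.notMem_erase l D) hkl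
    rw [Finset.insert_erase hlD] at hL
    linarith

/-! ### The lattice inequalities from the local ones, and back -/

/-- **SUBMODULAR FROM NON-NEGATIVE LOCAL DEFECTS (the local criterion).** If every local defect of `f` inside `M` is
`≥ 0`, then `f(A ∪ B) + f(A ∩ B) ≤ f(A) + f(B)` for all `A, B ⊆ M`. -/
theorem submodular_of_local_nonneg {M : Finset (Fin 28)} {f : Finset (Fin 28) → ℝ}
    (hloc : ∀ S, S ⊆ M → ∀ k ∈ M, ∀ l ∈ M, k ∉ S → l ∉ S → k ≠ l →
      f (insert k (insert l S)) + f S ≤ f (insert k S) + f (insert l S)) :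
    ∀ A B : Finset (Fin 28), A ⊆ M → B ⊆ M → f (A ∪ B) + f (A ∩ B) ≤ f A + f B := by
  classical
  suffices h : ∀ n : ℕ, ∀ A B : Finset (Fin 28), A ⊆ M → B ⊆ M → (A \ B).card = n →
      f (A ∪ B) + f (A ∩ B) ≤ f A + f B from fun A B hA hB => h _ A B hA hB rfl
  intro n
  induction n with
  | zero =>
    intro A B _ _ hcard
    have hAB : A ⊆ B := fun x hx => by
      by_contra hxB
      have : x ∈ A \ B := Finset.mem_sdiff.mpr ⟨hx, hxB⟩
      rw [Finset.card_eq_zero.mp hcard] at this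
      exact absurd this (Finset.notMem_empty _)
    rw [Finset.union_eq_right.mpr hAB, Finset.inter_eq_left.mpr hAB, add_comm]
  | succ n ih =>
    intro A B hA hB hcard
    obtain ⟨x, hx⟩ : (A \ B).Nonempty := Finset.card_pos.mp (by omega)
    obtain ⟨hxA, hxB⟩ := Finset.mem_sdiff.mp hx
    -- peel `x`: `A = insert x A'`, `A' = A.erase x`
    have hA'M : A.erase x ⊆ M := (Finset.erase_subset _ _).trans hA
    have hcard' : (A.erase x \ B).card = n := by
      rw [Finset.erase_sdiff_comm, Finset.card_erase_of_mem hx, hcard]; rfl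
    have hIH := ih (A.erase x) B hA'M hB hcard'
    -- the marginal of `x` on `A' ∪ B` is at most its marginal on `A'`
    have hmarg := marginal_le_of_local_nonneg hloc (Finset.subset_union_left (s₁ := A.erase x) (s₂ := B))
      (Finset.union_subset hA'M hB) (hA hxA)
      (fun h => by rcases Finset.mem_union.mp h with h | h
                   · exact Finset.notMem_erase x A h
                   · exact hxB h)
    have e1 : insert x (A.erase x ∪ B) = A ∪ B := by rw [← Finset.insert_union, Finset.insert_erase hxA]
    have e2 : insert x (A.erase x) = A := Finset.insert_erase hxA
    have e3 : A.erase x ∩ B = A ∩ B := by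
      rw [Finset.erase_inter, Finset.erase_eq_of_notMem]
      exact fun h => hxB (Finset.mem_inter.mp h).2
    rw [e1, e2] at hmarg
    rw [e3] at hIH
    linarith

/-- The converse: a submodular `f` on the subsets of `M` has non-negative local defects. -/
theorem local_nonneg_of_submodular {M : Finset (Fin 28)} {f : Finset (Fin 28) → ℝ}
    (hsub : ∀ A B : Finset (Fin 28), A ⊆ M → B ⊆ M → f (A ∪ B) + f (A ∩ B) ≤ f A + f B)
    {S : Finset (Fin 28)} (hS : S ⊆ M) {k l : Fin 28} (hk : k ∈ M) (hl : l ∈ M) (hkS : k ∉ S) (hlS : l ∉ S)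
    (hkl : k ≠ l) : f (insert k (insert l S)) + f S ≤ f (insert k S) + f (insert l S) := by
  classical
  have h := hsub (insert k S) (insert l S) (Finset.insert_subset hk hS) (Finset.insert_subset hl hS)
  have e1 : insert k S ∪ insert l S = insert k (insert l S) := by
    ext y; simp only [Finset.mem_union, Finset.mem_insert]; tauto
  have e2 : insert k S ∩ insert l S = S := by
    ext y
    simp only [Finset.mem_inter, Finset.mem_insert]
    constructor
    · rintro ⟨h1 | h1, h2 | h2⟩
      · exact absurd (h1.symm.trans h2) hkl
      · exact absurd (h1 ▸ h2) hkS
      · exact absurd (h2 ▸ h1) hlS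
      · exact h1
    · intro hy; exact ⟨Or.inr hy, Or.inr hy⟩
  rw [e1, e2] at h
  exact h

/-- **SUPERMODULAR FROM NON-POSITIVE LOCAL DEFECTS** (the mirror, `f ↦ −f`). -/
theorem supermodular_of_local_nonpos {M : Finset (Fin 28)} {f : Finset (Fin 28) → ℝ}
    (hloc : ∀ S, S ⊆ M → ∀ k ∈ M, ∀ l ∈ M, k ∉ S → l ∉ S → k ≠ l →
      f (insert k S) + f (insert l S) ≤ f (insert k (insert l S)) + f S) :
    ∀ A B : Finset (Fin 28), A ⊆ M → B ⊆ M → f A + f B ≤ f (A ∪ B) + f (A ∩ B) := by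
  intro A B hA hB
  have h := submodular_of_local_nonneg (M := M) (f := fun X => -f X)
    (fun S hS k hk l hl hkS hlS hkl => by linarith [hloc S hS k hk l hl hkS hlS hkl]) A B hA hB
  linarith

/-- The converse: a supermodular `f` on the subsets of `M` has non-positive local defects. -/
theorem local_nonpos_of_supermodular {M : Finset (Fin 28)} {f : Finset (Fin 28) → ℝ}
    (hsuper : ∀ A B : Finset (Fin 28), A ⊆ M → B ⊆ M → f A + f B ≤ f (A ∪ B) + f (A ∩ B))
    {S : Finset (Fin 28)} (hS : S ⊆ M) {k l : Fin 28} (hk : k ∈ M) (hl : l ∈ M) (hkS : k ∉ S) (hlS : l ∉ S)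
    (hkl : k ≠ l) : f (insert k S) + f (insert l S) ≤ f (insert k (insert l S)) + f S := by
  have h := local_nonneg_of_submodular (M := M) (f := fun X => -f X)
    (fun A B hA hB => by linarith [hsuper A B hA hB]) hS hk hl hkS hlS hkl
  linarith

/-- **MODULAR FROM VANISHING LOCAL DEFECTS**: no kink behind any prefix ⇒ `f(A ∪ B) + f(A ∩ B) = f(A) + f(B)` for all
`A, B ⊆ M`. -/
theorem modular_of_local_zero {M : Finset (Fin 28)} {f : Finset (Fin 28) → ℝ}
    (hloc : ∀ S, S ⊆ M → ∀ k ∈ M, ∀ l ∈ M, k ∉ S → l ∉ S → k ≠ l →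
      f (insert k S) + f (insert l S) = f (insert k (insert l S)) + f S) :
    ∀ A B : Finset (Fin 28), A ⊆ M → B ⊆ M → f (A ∪ B) + f (A ∩ B) = f A + f B := by
  intro A B hA hB
  have h1 := submodular_of_local_nonneg (M := M) (f := f)
    (fun S hS k hk l hl hkS hlS hkl => (hloc S hS k hk l hl hkS hlS hkl).ge) A B hA hB
  have h2 := supermodular_of_local_nonpos (M := M) (f := f)
    (fun S hS k hk l hl hkS hlS hkl => (hloc S hS k hk l hl hkS hlS hkl).le) A B hA hB
  linarith

/-! ### On the period: junction-wise local signs give the type of `F` -/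

/-- **JUNCTION-WISE NON-NEGATIVE DEFECTS MAKE THE PERIOD PATTERN FUNCTION SUBMODULAR.** For
`F(A) = Σ_{m<N} f m (A ∩ M m)`: if at every junction `m < N` every local defect of `f m` inside `M m` is `≥ 0`, then
`F(A ∪ B) + F(A ∩ B) ≤ F(A) + F(B)` for ALL `A, B` (the pooled wall defects of `F` are sums of junction defects,
`period_defect_eq_sum_junction_defects`; then the local criterion on all 28 forms). -/
theorem period_submodular_of_junction_local_nonneg {N : ℕ} {M : ℕ → Finset (Fin 28)}
    {f : ℕ → Finset (Fin 28) → ℝ} {F : Finset (Fin 28) → ℝ}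
    (hF : ∀ A, F A = ∑ m ∈ Finset.range N, f m (A ∩ M m))
    (hloc : ∀ m < N, ∀ S, S ⊆ M m → ∀ k ∈ M m, ∀ l ∈ M m, k ∉ S → l ∉ S → k ≠ l →
      f m (insert k (insert l S)) + f m S ≤ f m (insert k S) + f m (insert l S)) :
    ∀ A B : Finset (Fin 28), F (A ∪ B) + F (A ∩ B) ≤ F A + F B := by
  classical
  intro A B
  refine submodular_of_local_nonneg (M := Finset.univ) (f := F) (fun S _ k _ l _ hkS hlS hkl => ?_) A B
    (Finset.subset_univ _) (Finset.subset_univ _)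
  have h := period_defect_eq_sum_junction_defects hF S k l
  have hsum : 0 ≤ ∑ m ∈ (Finset.range N).filter (fun m => k ∈ M m ∧ l ∈ M m),
      (f m (insert k (S ∩ M m)) + f m (insert l (S ∩ M m)) - f m (S ∩ M m) -
        f m (insert k (insert l (S ∩ M m)))) := by
    refine Finset.sum_nonneg fun m hm => ?_
    obtain ⟨hmN, hkm, hlm⟩ := Finset.mem_filter.mp hm
    have := hloc m (Finset.mem_range.mp hmN) (S ∩ M m) Finset.inter_subset_right k hkm l hlm
      (fun h' => hkS (Finset.mem_inter.mp h').1) (fun h' => hlS (Finset.mem_inter.mp h').1) hkl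
    linarith
  linarith

/-- **JUNCTION-WISE NON-POSITIVE DEFECTS MAKE THE PERIOD PATTERN FUNCTION SUPERMODULAR.** -/
theorem period_supermodular_of_junction_local_nonpos {N : ℕ} {M : ℕ → Finset (Fin 28)}
    {f : ℕ → Finset (Fin 28) → ℝ} {F : Finset (Fin 28) → ℝ}
    (hF : ∀ A, F A = ∑ m ∈ Finset.range N, f m (A ∩ M m))
    (hloc : ∀ m < N, ∀ S, S ⊆ M m → ∀ k ∈ M m, ∀ l ∈ M m, k ∉ S → l ∉ S → k ≠ l →
      f m (insert k S) + f m (insert l S) ≤ f m (insert k (insert l S)) + f m S) :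
    ∀ A B : Finset (Fin 28), F A + F B ≤ F (A ∪ B) + F (A ∩ B) := by
  classical
  intro A B
  refine supermodular_of_local_nonpos (M := Finset.univ) (f := F) (fun S _ k _ l _ hkS hlS hkl => ?_) A B
    (Finset.subset_univ _) (Finset.subset_univ _)
  have h := period_defect_eq_sum_junction_defects hF S k l
  have hsum : ∑ m ∈ (Finset.range N).filter (fun m => k ∈ M m ∧ l ∈ M m),
      (f m (insert k (S ∩ M m)) + f m (insert l (S ∩ M m)) - f m (S ∩ M m) -
        f m (insert k (insert l (S ∩ M m)))) ≤ 0 := by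
    refine Finset.sum_nonpos fun m hm => ?_
    obtain ⟨hmN, hkm, hlm⟩ := Finset.mem_filter.mp hm
    have := hloc m (Finset.mem_range.mp hmN) (S ∩ M m) Finset.inter_subset_right k hkm l hlm
      (fun h' => hkS (Finset.mem_inter.mp h').1) (fun h' => hlS (Finset.mem_inter.mp h').1) hkl
    linarith
  linarith

/-! ### Reading on the cusp: junction-wise convex kinks only ⇒ a local maximiser is cusp-free -/

/-- **JUNCTION-WISE NON-NEGATIVE WALL DEFECTS ⇒ A LOCAL MAXIMISER IS CUSP-FREE.** At a Regular OPEN-box direction with a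
period `T`, `Q = C₁ + δ₂₈ − Φ > 0`, which is a local maximiser of the MODEL `γ` (P2 g23's hypotheses verbatim), with
junction data `M m`, `f m` (agreement hypotheses `hf`) and `F(A) = Σ_m f m (A ∩ M m)`: if at every junction every local
defect behind every prefix is `≥ 0` (only CONVEX kinks), then `cuspSlope a T δ = 0` for every `δ`
(`period_submodular_of_junction_local_nonneg` + `cuspSlope_eq_zero_of_submodular_period_of_isLocalMax`). -/
theorem cuspSlope_eq_zero_of_junction_local_nonneg_of_isLocalMax {a : Dir}
    (hopen : ∀ j : Fin 7, 0 < sParam a j.succ ∧ sParam a j.succ < sParam a 0)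
    {T : ℝ} (hT : 0 < T) (hper : ∀ k : Fin 28, ∃ z : ℤ, T * h28 a k = z)
    (hQ : 0 < C1 a + delta28 a - phi30 a) (hreg : Regular a) (hmax : IsLocalMax gamma a)
    {M : ℕ → Finset (Fin 28)} {f : ℕ → Finset (Fin 28) → ℝ}
    (hf : ∀ m, m + 1 < (bkpts a T).card → ∀ Δ : Fin 8 → ℝ, (∀ k, |phiForm Δ k| < 1) →
      (∀ k, |phiForm Δ k| < wallDist a T) →
        (torusN (bkpt a T m • sParam a + Δ) : ℝ) = f m ((M m).filter fun k => 0 ≤ phiForm Δ k))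
    {F : Finset (Fin 28) → ℝ} (hF : ∀ A, F A = ∑ m ∈ Finset.range ((bkpts a T).card - 1), f m (A ∩ M m))
    (hloc : ∀ m < (bkpts a T).card - 1, ∀ S, S ⊆ M m → ∀ k ∈ M m, ∀ l ∈ M m, k ∉ S → l ∉ S → k ≠ l →
      f m (insert k (insert l S)) + f m S ≤ f m (insert k S) + f m (insert l S))
    (δ : Fin 8 → ℝ) : cuspSlope a T δ = 0 :=
  cuspSlope_eq_zero_of_submodular_period_of_isLocalMax hopen hT hper hQ hreg hmax hf hF
    (period_submodular_of_junction_local_nonneg hF hloc) δ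

/-- **JUNCTION-WISE NON-POSITIVE WALL DEFECTS ⇒ THE HULL CERTIFICATE APPLIES** (only CONCAVE kinks at every junction
behind every prefix ⇒ `F` supermodular ⇒ `cuspSlope_nonpos_of_hull_certificate_coord`): zero in the convex hull of
finitely many chamber gradients, checked on the 8 coordinate displacements, gives `σ ≤ 0` in every direction. -/
theorem cuspSlope_nonpos_of_junction_local_nonpos_of_hull_certificate {a : Dir} (hpos : ∀ k, 0 < h28 a k) {T : ℝ}
    (hT : 0 < T) (hper : ∀ k : Fin 28, ∃ z : ℤ, T * h28 a k = z)
    {M : ℕ → Finset (Fin 28)} {f : ℕ → Finset (Fin 28) → ℝ}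
    (hf : ∀ m, m + 1 < (bkpts a T).card → ∀ Δ : Fin 8 → ℝ, (∀ k, |phiForm Δ k| < 1) →
      (∀ k, |phiForm Δ k| < wallDist a T) →
        (torusN (bkpt a T m • sParam a + Δ) : ℝ) = f m ((M m).filter fun k => 0 ≤ phiForm Δ k))
    {F : Finset (Fin 28) → ℝ} (hF : ∀ A, F A = ∑ m ∈ Finset.range ((bkpts a T).card - 1), f m (A ∩ M m))
    (hloc : ∀ m < (bkpts a T).card - 1, ∀ S, S ⊆ M m → ∀ k ∈ M m, ∀ l ∈ M m, k ∉ S → l ∉ S → k ≠ l →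
      f m (insert k S) + f m (insert l S) ≤ f m (insert k (insert l S)) + f m S)
    {ι : Type*} (s : Finset ι) (δ₀ : ι → Fin 8 → ℝ)
    (hgen : ∀ j ∈ s, ∀ k l : Fin 28, k ≠ l → phiForm (δ₀ j) k / h28 a k ≠ phiForm (δ₀ j) l / h28 a l)
    (t : ι → ℝ) (ht : ∀ j ∈ s, 0 ≤ t j) (htpos : 0 < ∑ j ∈ s, t j)
    (hzero : ∀ p : Fin 8, ∑ j ∈ s, t j *
      ∑ k, (F (Finset.univ.filter fun l => phiForm (δ₀ j) k / h28 a k ≤ phiForm (δ₀ j) l / h28 a l) -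
          F (Finset.univ.filter fun l => phiForm (δ₀ j) k / h28 a k < phiForm (δ₀ j) l / h28 a l)) *
        (phiForm (Pi.single p (1 : ℝ)) k / h28 a k) = 0)
    (δ : Fin 8 → ℝ) : cuspSlope a T δ ≤ 0 :=
  cuspSlope_nonpos_of_hull_certificate_coord hpos hT hper hf hF (period_supermodular_of_junction_local_nonpos hF hloc)
    s δ₀ hgen t ht htpos hzero δ

end Summit.KontsevichZagierPeriods.Zeta5Search.Barrier.ConeGamma

end
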